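import Mathlib
import Summits.NavierStokesRegularity.NavierStokesRegularity.Theorems.FilamentSkeletonRssStadiumDescentShortChord
import Summits.NavierStokesRegularity.NavierStokesRegularity.Theorems.FilamentSkeletonRssStadiumPlateauShortChord

/-!
# Route `FilamentSkeletonRss` · child crux `TangentSkeletonNearStraightL` (stmt-NavierStokesRegularity-23320) · registered line
# `child_tangent_analytic_strip_L` (b0b56c52900dd90a), stub `stub_stripPropagation` — assembly: RIGHT SIDE OF THE REGISTERED CORNER, NEAR SOURCES, WITH NUMBERS

First part of item R1 of the quarter-width blueprint (evidence `CORNER-QUARTER-BLUEPRINT-leafhand-15-g0.md` v5 on 23320).  The contour for a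
target `z = x₀ + iY` in the right output corner region (`0 ≤ Y < hs/4`, `cc ≤ x₀ < cc + L + hs/4`) leaves `z` to the right along the plateau
`ζ = z + D`, `0 ≤ D ≤ hs/5`, then descends along `ζ(f) = (x₀ + hs/5 + (3hs/10)f) + i·Y(1−f)`, `f ∈ [0,1]`, to the real axis at `x₀ + hs/2`.
With `‖F′‖ ≤ 2` and NO hypothesis on the tangent oscillation, the second-order tools certify the near sources:
* `corner_right_plateau_re_pos` — plateau sources `0 ≤ D ≤ hs/5` (`Theorems.StadiumPlateauShortChord`, disc radius `hs/2`);
* `corner_right_descent_near_re_pos` — descent sources with `f ≤ 2/5` (`Theorems.StadiumDescentShortChord`, cone slope `1/3`, disc radius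
  `hs(11/20 − 3f/10)`; the polynomial inequality `(1/5+3f/10)² + f²/16 ≤ (4/5)(11/20−3f/10)²` on `[0, 2/5]`).
The remaining descent sources (`f > 2/5`) and the real axis beyond are items for `Theorems.StadiumHybridChord` / `Theorems.StadiumFootClosedForm`
/ `Theorems.StadiumFootBare` with numbers (R1 continued).
HONEST FRAMING: bookkeeping for a HYPOTHETICAL filament skeleton on the NEGATIVE side of a MODEL route; the stub `stub_stripPropagation` is NOT
closed by this file; nothing here bears on Navier–Stokes regularity or blow-up.  `--supports stmt-NavierStokesRegularity-23320`.
-/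

set_option linter.dupNamespace false

noncomputable section

namespace Summit.NavierStokesRegularity.NavierStokesRegularity.Theorems.StadiumCornerRightNear

open Set Metric
open Summit.NavierStokesRegularity.NavierStokesRegularity.Theorems.StadiumDescentShortChord
open Summit.NavierStokesRegularity.NavierStokesRegularity.Theorems.StadiumPlateauShortChord

/-- **Right plateau sources.**  Stadium `S`, `F` holomorphic with `‖F′‖ ≤ 2`, `Σ (F′)ᵢ² = 1`; target `z = x₀ + iY` with `|Y| < hs/4`,
`cc ≤ x₀ < cc + L + hs/4`; plateau source `z + D`, `0 ≤ D ≤ hs/5`; core term `0 < κ`, `0 < g₀ ≤ Re Gv`: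
`0 < Re(Σᵢ (Fᵢ(z+D) − Fᵢ(z))² + κ·Gv)`. [folklore] -/
theorem corner_right_plateau_re_pos {hs L cc : ℝ} {F : ℂ → (Fin 3 → ℂ)}
    (hF : DifferentiableOn ℂ F {z : ℂ | |z.im| < hs ∧ |z.re - cc| < L + hs})
    (hM : ∀ z ∈ {z : ℂ | |z.im| < hs ∧ |z.re - cc| < L + hs}, ‖deriv F z‖ ≤ 2)
    (hunit : ∀ w ∈ {z : ℂ | |z.im| < hs ∧ |z.re - cc| < L + hs}, ∑ i, (deriv F w i) ^ 2 = 1)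
    (hhs : 0 < hs) {x₀ Y D : ℝ} (hY : |Y| < hs / 4) (hx₀ : x₀ < cc + L + hs / 4) (hx₀cc : cc ≤ x₀)
    (hD0 : 0 ≤ D) (hD : D ≤ hs / 5)
    {κ g₀ : ℝ} {Gv : ℂ} (hκ : 0 < κ) (hg₀ : 0 < g₀) (hG : g₀ ≤ Gv.re) :
    0 < ((∑ i, (F (((x₀ : ℂ) + (Y : ℂ) * Complex.I) + (D : ℂ)) i - F ((x₀ : ℂ) + (Y : ℂ) * Complex.I) i) ^ 2) +
      (κ : ℂ) * Gv).re := by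
  have hzim : ((x₀ : ℂ) + (Y : ℂ) * Complex.I).im = Y := by simp
  have hzre : ((x₀ : ℂ) + (Y : ℂ) * Complex.I).re = x₀ := by simp
  refine plateau_chord_re_pos (d := hs / 2) hF hM hunit (by positivity) ?_ ?_ ?_ ?_ (by norm_num) hκ hg₀ hG
  · rw [hzim]; linarith
  · rw [hzre, abs_of_nonneg (by linarith)]; linarith
  · rw [hzre, abs_of_nonneg (by linarith)]; linarith
  · rw [abs_of_nonneg hD0]; linarith

/-- The dimensionless short-chord inequality of the near descent: `(1/5+3f/10)² + f²/16 ≤ (4/5)(11/20−3f/10)²` on `[0, 2/5]`. [folklore] -/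
theorem near_descent_poly {f : ℝ} (hf0 : 0 ≤ f) (hf : f ≤ 2 / 5) :
    (1 / 5 + 3 / 10 * f) ^ 2 + f ^ 2 / 16 ≤ (4 / 5 : ℝ) * (11 / 20 - 3 / 10 * f) ^ 2 := by
  nlinarith [mul_nonneg (sub_nonneg.2 hf) (by linarith : (0:ℝ) ≤ 2 / 5 + f), mul_nonneg hf0 hf0]

/-- **Right descent, near sources (`f ≤ 2/5`).**  Stadium `S`, `F` holomorphic with `‖F′‖ ≤ 2`, `Σ (F′)ᵢ² = 1`; target `z = x₀ + iY` with
`0 ≤ Y < hs/4`, `cc ≤ x₀ < cc + L + hs/4`; descent source `ζ(f) = (x₀ + hs/5 + (3hs/10)f) + iY(1−f)` with `0 ≤ f ≤ 2/5`; core term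
`0 < κ`, `0 < g₀ ≤ Re Gv`: `0 < Re(Σᵢ (Fᵢ(ζ) − Fᵢ(z))² + κ·Gv)`. [folklore] -/
theorem corner_right_descent_near_re_pos {hs L cc : ℝ} {F : ℂ → (Fin 3 → ℂ)}
    (hF : DifferentiableOn ℂ F {z : ℂ | |z.im| < hs ∧ |z.re - cc| < L + hs})
    (hM : ∀ z ∈ {z : ℂ | |z.im| < hs ∧ |z.re - cc| < L + hs}, ‖deriv F z‖ ≤ 2)
    (hunit : ∀ w ∈ {z : ℂ | |z.im| < hs ∧ |z.re - cc| < L + hs}, ∑ i, (deriv F w i) ^ 2 = 1)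
    (hhs : 0 < hs) {x₀ Y f : ℝ} (hY0 : 0 ≤ Y) (hY : Y < hs / 4) (hx₀ : x₀ < cc + L + hs / 4) (hx₀cc : cc ≤ x₀)
    (hf0 : 0 ≤ f) (hf : f ≤ 2 / 5)
    {κ g₀ : ℝ} {Gv : ℂ} (hκ : 0 < κ) (hg₀ : 0 < g₀) (hG : g₀ ≤ Gv.re) :
    0 < ((∑ i, (F (((x₀ : ℂ) + (Y : ℂ) * Complex.I) +
        (((hs / 5 + 3 * hs / 10 * f : ℝ) : ℂ) - ((Y * f : ℝ) : ℂ) * Complex.I)) i -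
        F ((x₀ : ℂ) + (Y : ℂ) * Complex.I) i) ^ 2) + (κ : ℂ) * Gv).re := by
  set z : ℂ := (x₀ : ℂ) + (Y : ℂ) * Complex.I with hz
  set s : ℂ := ((hs / 5 + 3 * hs / 10 * f : ℝ) : ℂ) - ((Y * f : ℝ) : ℂ) * Complex.I with hsdef
  have hsre : s.re = hs / 5 + 3 * hs / 10 * f := by simp [hsdef]
  have hsim : s.im = -(Y * f) := by simp [hsdef]
  have hzim : z.im = Y := by simp [hz]
  have hzre : z.re = x₀ := by simp [hz]
  have hzsim : (z + s).im = Y - Y * f := by rw [Complex.add_im, hzim, hsim]; ring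
  have hzsre : (z + s).re = x₀ + (hs / 5 + 3 * hs / 10 * f) := by rw [Complex.add_re, hzre, hsre]
  -- disc radius along the chord and the cone slope
  set d : ℝ := hs * (11 / 20 - 3 / 10 * f) with hd
  have hhsf0 : 0 ≤ hs * f := mul_nonneg hhs.le hf0
  have hhsf : hs * f ≤ hs * (2 / 5) := mul_le_mul_of_nonneg_left hf hhs.le
  have hYf0 : 0 ≤ Y * f := mul_nonneg hY0 hf0
  have hYf1 : Y * f ≤ Y := mul_le_of_le_one_right hY0 (by linarith)
  have hd' : d = hs * (11 / 20) - 3 / 10 * (hs * f) := by rw [hd]; ring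
  have hdpos : 0 < d := by rw [hd']; linarith
  have hv0 : |z.im| + d < hs := by rw [hzim, abs_of_nonneg hY0, hd']; linarith
  have hv1 : |(z + s).im| + d < hs := by
    rw [hzsim, abs_of_nonneg (by linarith), hd']; linarith
  have hh0 : |z.re - cc| + d < L + hs := by rw [hzre, abs_of_nonneg (by linarith), hd']; linarith
  have hh1 : |(z + s).re - cc| + d < L + hs := by
    have e : x₀ + (hs / 5 + 3 * hs / 10 * f) - cc = (x₀ - cc) + hs / 5 + 3 / 10 * (hs * f) := by ring
    rw [hzsre, e, abs_of_nonneg (by linarith), hd']; linarith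
  have hcone : |s.im| ≤ (1 / 3 : ℝ) * |s.re| := by
    have e : hs / 5 + 3 * hs / 10 * f = hs / 5 + 3 / 10 * (hs * f) := by ring
    rw [hsim, hsre, abs_neg, abs_of_nonneg hYf0, e, abs_of_nonneg (by linarith)]
    have h2 : Y * f ≤ hs / 4 * f := mul_le_mul_of_nonneg_right hY.le hf0
    have e2 : hs / 4 * f = 1 / 4 * (hs * f) := by ring
    rw [e2] at h2
    linarith
  -- the short-chord condition `(M/d)²/4·‖s‖²·(1+λ²) ≤ 1 − λ²`, i.e. `‖s‖² ≤ (4/5)d²`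
  have hnorm : ‖s‖ ^ 2 = (hs / 5 + 3 * hs / 10 * f) ^ 2 + (Y * f) ^ 2 := by
    rw [Complex.sq_norm, Complex.normSq_apply, hsre, hsim]; ring
  have hpoly : (hs / 5 + 3 * hs / 10 * f) ^ 2 + (Y * f) ^ 2 ≤ (4 / 5) * d ^ 2 := by
    have hYf : (Y * f) ^ 2 ≤ hs ^ 2 * (f ^ 2 / 16) := by
      have h1 : 0 ≤ Y * f := mul_nonneg hY0 hf0
      have h2 : Y * f ≤ hs / 4 * f := mul_le_mul_of_nonneg_right hY.le hf0
      have h3 : (Y * f) ^ 2 ≤ (hs / 4 * f) ^ 2 := pow_le_pow_left₀ h1 h2 2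
      have h4 : (hs / 4 * f) ^ 2 = hs ^ 2 * (f ^ 2 / 16) := by ring
      rw [h4] at h3; exact h3
    -- the dimensionless polynomial inequality on `[0, 2/5]`
    have hP := near_descent_poly hf0 hf
    have hhs2 : 0 ≤ hs ^ 2 := sq_nonneg hs
    calc (hs / 5 + 3 * hs / 10 * f) ^ 2 + (Y * f) ^ 2
        ≤ (hs / 5 + 3 * hs / 10 * f) ^ 2 + hs ^ 2 * (f ^ 2 / 16) := by linarith
      _ = hs ^ 2 * ((1 / 5 + 3 / 10 * f) ^ 2 + f ^ 2 / 16) := by ring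
      _ ≤ hs ^ 2 * ((4 / 5 : ℝ) * (11 / 20 - 3 / 10 * f) ^ 2) := mul_le_mul_of_nonneg_left hP hhs2
      _ = (4 / 5) * d ^ 2 := by rw [hd]; ring
  have hshort : (2 / d) ^ 2 / 4 * ‖s‖ ^ 2 * (1 + (1 / 3 : ℝ) ^ 2) ≤ 1 - (1 / 3 : ℝ) ^ 2 := by
    rw [hnorm]
    have hd2 : 0 < d ^ 2 := by positivity
    have h1 : ((hs / 5 + 3 * hs / 10 * f) ^ 2 + (Y * f) ^ 2) / d ^ 2 ≤ 4 / 5 := by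
      rw [div_le_iff₀ hd2]; linarith [hpoly]
    have e : (2 / d) ^ 2 / 4 * ((hs / 5 + 3 * hs / 10 * f) ^ 2 + (Y * f) ^ 2) * (1 + (1 / 3 : ℝ) ^ 2) =
        (((hs / 5 + 3 * hs / 10 * f) ^ 2 + (Y * f) ^ 2) / d ^ 2) * (10 / 9) := by
      field_simp
      ring
    rw [e]
    linarith
  have h := descent_chord_re_pos hF hM hunit hdpos hv0 hv1 hh0 hh1 hcone hshort hκ hg₀ hG
  simpa only [hz, hsdef] using h

end Summit.NavierStokesRegularity.NavierStokesRegularity.Theorems.StadiumCornerRightNear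

end
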